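import Literature.NumberTheory.LFunctions.SuzukiScrewLineRepairedThm14
import Literature.NumberTheory.LFunctions.SuzukiWeilModelSpace
import Mathlib.Analysis.Distribution.SchwartzSpace.Fourier
import Mathlib.Analysis.Fourier.FourierTransformDeriv
import Mathlib.Analysis.Calculus.BumpFunction.Basic
import HarnessLib

/-!
# CJM Thm 5.6, last clause, over the repaired screw line — DISCHARGED: under RH, `V(0)` is the `L²`-closure of `V°(0)ᴿ`

LINE 1 — LABEL: RH-CONSEQUENCE PROVED (binder `RiemannHypothesis →` explicit and never dropped):
`Suzuki2025_thm56_closureR_holds : Suzuki2025_thm56_closureR`, i.e.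
`RiemannHypothesis → closure suzukiVcircR = suzukiV 0`; the auxiliary density / dictionary lemmas
are RH-FREE. Theorems only; no definition, no named fact; net debt −1. bears_on: B-C/B-P (LADDER-RH
COLUMN 6 DBR). WHAT THIS IS NOT: a printed consequence of RH formalised as such — it fixes the
kernel status of one named fact of the repaired CJM §5 block; the criteria
`Suzuki2025_thm14R`/`thm44R`/`cor15R` are RH-EQUIVALENT·PRINTED and (1.9)ᴿ/(1.10)ᴿ themselves are
shown by nobody; it does not move RH; nothing here bears on the truth of RH.

Source: M. Suzuki, *On the Hilbert space derived from the Weil distribution*, Canad. J. Math. 2025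
= arXiv:2301.00421v3 [Suzuki2025WeilHilbertSpace], Thm 5.6 (TeX l.1799–1809: "In particular,
`V(0)` is the `L²`-closure of `V°(0)`"), its proof (TeX l.1811–1840), (3.8) (TeX l.1050–1058),
Prop 4.1 (TeX l.1120–1141), Lemma 5.1 (TeX l.1464–1471), Lemma 5.4 (TeX l.1559–1660:
`𝓗_W ≅ L²(τ)`), over the REPAIRED objects of the cell (erratum E21: `screwPhatR`, `IsVcircRepR`,
`suzukiVcircR` of `SuzukiScrewLineRepaired.lean`).

## The printed proof and how it is followed

Printed (TeX l.1811–1840): for `ψ ∈ C_c^∞(ℝ)`, `‖P̂_{Dψ}‖² = π Σ_γ m_γ|ψ̂(γ)|² = π⟨ψ,ψ⟩_W` by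
(1.2), (3.8) and Prop 4.1, so `𝓚₀ ⊂ 𝓚(Θ)`; and the extended map `P̂_D : 𝓗_W → 𝓚(Θ)` is the
inverse of the isometric isomorphism `V(0) ≅ 𝓗_W` of Thm 5.5 (2) — which rests on
`𝓗_W ≅ L²(τ)` (Lemma 5.4, [KrLa14, §§5.3, 12.5]) — hence ONTO `𝓚(Θ) = 𝖥(V(0))` (Lemma 5.1);
therefore `V(0) = 𝖥⁻¹𝓚(Θ)` is the `L²`-closure of `V°(0) = 𝖥⁻¹P̂_D(C_c^∞(ℝ))`.

Here, with the tree's objects (all inputs are landed theorems of the cell):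
* (E) **(3.8)ᴿ as an `L²(ℝ)`-expansion** (`hasSum_smul_screwBasis_toLp_screwPhatR`): under RH,
  `[P̂ᴿ_{Dψ}] = Σ_ρ c_ρ(ψ)·[F_ρ]` in `L²(ℝ)` with `c_ρ(ψ) = −√(πm_ρ)ψ̂(γ_ρ)` (a.e. identity
  `screwPhatR_suzukiD_eq_tsum_screwBasis` of the cell + CJM Prop 4.1 `Suzuki2025_prop41_holds`
  (orthonormality of `[F_ρ]`) + "an `L²`-sum converging a.e. is the a.e. sum").
* (O) CJM Prop 4.1 (`Suzuki2025_prop41_holds`): `𝓚(Θ_ξ) = modelSpaceL2 lagariasTheta` is the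
  closed span of the orthonormal `[F_ρ]`; Lemma 5.1 (i) in Suzuki's normalisation
  (`suzukiFourierL2_mem_modelSpaceL2_iff`): `𝖥ψ ∈ 𝓚(Θ_ξ) ↔ ψ ∈ V(0)`.
* (D) **Density of the test-function values `(ψ̂(γ_ρ))_ρ` in `ℓ²(Γ, m)`** — the part of
  "`𝓗_W ≅ L²(τ)` is onto" (Lemma 5.4 via [KrLa14]) that Thm 5.6 uses
  (`exists_isWeilTest_hatValues_tendsto`): for each zero `ρ₀` there are test functions `ψ_n` with
  `|ψ̂_n(γ_ρ) − δ_{ρρ₀}| ≤ ε_n/(1 + |γ_ρ|)`, `ε_n → 0`: `ψ_n = χ(·/n)·𝓕⁻¹g` for a bump `g`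
  isolating `γ_{ρ₀}` (the zeros are isolated), with `sup_u (1+|u|)|ĥ(u)| ≤ ‖h‖₁ + ‖h′‖₁` for
  `h = ψ_n − 𝓕⁻¹g` (one integration by parts, `Real.fourier_deriv`) and dominated convergence.
* (L) Glue (`Suzuki2025_thm56_closureR_holds`): `𝖥(V°(0)ᴿ) = {[P̂ᴿ_{Dψ}]}` is a subspace inside
  the closed span `M` of the `[F_ρ]` (by (E)); each `[F_{ρ₀}]` is an `L²`-limit of
  `[P̂ᴿ_{Dψ_n}]` (by (D), (E) and Parseval), so `closure 𝖥(V°(0)ᴿ) = M = 𝓚(Θ_ξ) = 𝖥(V(0))`;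
  `𝖥 = suzukiFourierL2` is a linear homeomorphism of `L²(ℝ)` up to `√(2π)`
  (`norm_sq_suzukiFourierL2`), so `closure V°(0)ᴿ = V(0)`.

Deviation from print: the completion `𝓗_W` and the measure `τ` are not materialised (GUARD R7 of
the cell: they exist as the printed objects only under RH); the density statement (D) is proved
directly for the sequences `(ψ̂(γ_ρ))_ρ`, which is exactly what the surjectivity of
`P̂_D : 𝓗_W → 𝓚(Θ)` amounts to after Prop 4.1.

## References
* [Suzuki2025WeilHilbertSpace] M. Suzuki, Canad. J. Math. 2025 = arXiv:2301.00421v3, Thm 5.6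
  (TeX l.1799–1840), (3.8) (l.1050–1058), Prop 4.1 (l.1120–1141), Lemma 5.1 (l.1464–1471),
  Lemma 5.4 (l.1559–1660), Cor 1.5 (l.438–451).
* [KrLa14] M. G. Kreĭn, H. Langer, *Continuation of Hermitian positive definite functions and
  related questions*, Integral Equations Operator Theory 78 (2014), §§5.3, 12.5 (cited by the
  source for `𝓗(G_g) ≅ L²(τ)`; not used here).
* Cell records: erratum E21 / row G-dbl-31 (`SuzukiScrewLineRepaired.lean`,
  `SuzukiScrewLineRepairedThm14.lean`).
-/

noncomputable section

open MeasureTheory Complex Filter Set Real FourierTransform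
open scoped ComplexConjugate Topology ENNReal InnerProductSpace FourierTransform

namespace Literature.NumberTheory.LFunctions

open ScrewLineRepairedExpansion ScrewLineRepairedThm14 ZetaZeros Literature.Analysis.Fourier

namespace SuzukiVcircClosure

/-! ## A. Generic `L²` lemmas (Parseval for an orthonormal family; `L²`-sums versus a.e. sums) -/

/-- An orthonormal family with square-summable coefficients is summable in the Hilbert space and
`‖Σ c_i v_i‖² = Σ |c_i|²` (Parseval for an orthonormal FAMILY). [folklore] -/
private theorem parseval_of_orthonormal {ι E : Type*} [NormedAddCommGroup E] [InnerProductSpace ℂ E]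
    [CompleteSpace E] {v : ι → E} (hv : Orthonormal ℂ v) {c : ι → ℂ}
    (hc : Summable fun i ↦ ‖c i‖ ^ 2) :
    Summable (fun i ↦ c i • v i) ∧ ‖∑' i, c i • v i‖ ^ 2 = ∑' i, ‖c i‖ ^ 2 := by
  classical
  have hV := hv.orthogonalFamily
  have hs : Summable fun i ↦ c i • v i := by
    have h := (hV.summable_iff_norm_sq_summable c).2 hc
    simpa [LinearIsometry.toSpanSingleton_apply] using h
  refine ⟨hs, ?_⟩
  have h1 : Tendsto (fun s : Finset ι ↦ ‖∑ i ∈ s, c i • v i‖ ^ 2) atTop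
      (𝓝 (‖∑' i, c i • v i‖ ^ 2)) :=
    ((continuous_norm.pow 2).tendsto _).comp hs.hasSum
  have h2 : Tendsto (fun s : Finset ι ↦ ∑ i ∈ s, ‖c i‖ ^ 2) atTop (𝓝 (∑' i, ‖c i‖ ^ 2)) :=
    hc.hasSum
  have heq : (fun s : Finset ι ↦ ‖∑ i ∈ s, c i • v i‖ ^ 2) = fun s ↦ ∑ i ∈ s, ‖c i‖ ^ 2 := by
    funext s
    have h := hV.norm_sum c s
    simpa [LinearIsometry.toSpanSingleton_apply] using h
  rw [heq] at h1
  exact tendsto_nhds_unique h1 h2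

/-- The class of a finite linear combination of `L²` functions is the pointwise combination, a.e.
[folklore] -/
private theorem coeFn_finset_sum_smul_toLp {ι : Type*} (s : Finset ι) {f : ι → ℝ → ℂ}
    (hf : ∀ i, MemLp (f i) 2 (volume : Measure ℝ)) (c : ι → ℂ) :
    ((∑ i ∈ s, c i • ((hf i).toLp (f i) : Lp ℂ 2 (volume : Measure ℝ)) : Lp ℂ 2 volume) : ℝ → ℂ)
      =ᵐ[volume] fun x ↦ ∑ i ∈ s, c i * f i x := by
  classical
  induction s using Finset.induction_on with
  | empty =>
    filter_upwards [Lp.coeFn_zero ℂ 2 (volume : Measure ℝ)] with x hx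
    simp only [Finset.sum_empty] at hx ⊢
    exact hx
  | @insert a s ha ih =>
    rw [Finset.sum_insert ha]
    filter_upwards [ih, Lp.coeFn_add (c a • ((hf a).toLp (f a) : Lp ℂ 2 volume))
      (∑ i ∈ s, c i • ((hf i).toLp (f i) : Lp ℂ 2 volume)),
      Lp.coeFn_smul (c a) ((hf a).toLp (f a) : Lp ℂ 2 volume), (hf a).coeFn_toLp] with x hx hadd hsm hfa
    rw [hadd, Pi.add_apply, hsm, Pi.smul_apply, hfa, hx, Finset.sum_insert ha, smul_eq_mul]

/-- **An `L²`-convergent series of `L²` functions that also converges pointwise a.e. has the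
pointwise sum as (a representative of) its `L²` sum** (countable index: along an exhausting
sequence of finite sets a subsequence of the partial sums converges a.e.). [folklore] -/
private theorem coeFn_tsum_smul_toLp_ae_eq {ι : Type*} [Countable ι] {f : ι → ℝ → ℂ}
    (hf : ∀ i, MemLp (f i) 2 (volume : Measure ℝ)) {c : ι → ℂ}
    (hs : Summable fun i ↦ c i • ((hf i).toLp (f i) : Lp ℂ 2 (volume : Measure ℝ)))
    (hpt : ∀ᵐ x : ℝ, Summable fun i ↦ c i * f i x) :
    ((∑' i, c i • ((hf i).toLp (f i) : Lp ℂ 2 (volume : Measure ℝ)) : Lp ℂ 2 volume) : ℝ → ℂ)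
      =ᵐ[volume] fun x ↦ ∑' i, c i * f i x := by
  classical
  set G : Lp ℂ 2 (volume : Measure ℝ) := ∑' i, c i • ((hf i).toLp (f i) : Lp ℂ 2 volume) with hG
  have hT : Tendsto (fun s : Finset ι ↦ ∑ i ∈ s, c i • ((hf i).toLp (f i) : Lp ℂ 2 volume))
      atTop (𝓝 G) := hs.hasSum
  have hM := tendstoInMeasure_of_tendsto_Lp hT
  haveI : (atTop : Filter (Finset ι)).NeBot := atTop_neBot
  obtain ⟨ns, hns, hae⟩ := hM.exists_seq_tendsto_ae'
  have hrep : ∀ᵐ x : ℝ, ∀ n : ℕ,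
      ((∑ i ∈ ns n, c i • ((hf i).toLp (f i) : Lp ℂ 2 volume) : Lp ℂ 2 volume) : ℝ → ℂ) x =
        ∑ i ∈ ns n, c i * f i x := by
    rw [ae_all_iff]
    intro n
    exact coeFn_finset_sum_smul_toLp (ns n) hf c
  filter_upwards [hae, hrep, hpt] with x hx hxrep hxpt
  have h1 : Tendsto (fun n : ℕ ↦ ∑ i ∈ ns n, c i * f i x) atTop (𝓝 (∑' i, c i * f i x)) :=
    hxpt.hasSum.comp hns
  have h2 : Tendsto (fun n : ℕ ↦ ∑ i ∈ ns n, c i * f i x) atTop (𝓝 ((G : ℝ → ℂ) x)) := by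
    refine hx.congr fun n ↦ ?_
    exact hxrep n
  exact tendsto_nhds_unique h2 h1

/-! ## B. (E) — (3.8)ᴿ as an `L²(ℝ)` expansion in the orthonormal family `[F_ρ]` (under RH) -/

/-- The (3.8)ᴿ coefficients `c_ρ(ψ) = −√(πm_ρ) ψ̂(γ_ρ)` are square-summable under RH, with
`Σ_ρ |c_ρ(ψ)|² = π Σ_ρ m_ρ|ψ̂(γ_ρ)|²` (`= π⟨ψ,ψ⟩_W`). RH-CONSEQUENCE (binder kept).
[cite: Suzuki2025WeilHilbertSpace, proof of Thm 5.6 (TeX l.1811–1816: "‖P̂_{Dψ}‖² = π Σ m_γ|ψ̂(γ)|² = π⟨ψ,ψ⟩_W")] -/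
theorem summable_norm_sq_coeff (hRH : RiemannHypothesis) {ψ : ℝ → ℂ} (hψ : IsWeilTest ψ) :
    Summable fun ρ : riemannZetaNontrivialZeros ↦
      ‖-((Real.sqrt (Real.pi * riemannZetaZeroOrder (ρ : ℂ)) : ℝ) : ℂ) *
        suzukiHat ψ (suzukiZeroParam (ρ : ℂ))‖ ^ 2 := by
  have hsumW := (weilQuadratic_eq_tsum_norm_sq_suzukiHat hRH hψ).1
  refine (hsumW.mul_left Real.pi).congr fun ρ ↦ ?_
  have hm0 : (0 : ℝ) ≤ riemannZetaZeroOrder (ρ : ℂ) := ZetaZeroSum.zeroOrder_nonneg ρ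
  simp only [norm_mul, norm_neg, Complex.norm_real, Real.norm_of_nonneg (Real.sqrt_nonneg _)]
  rw [mul_pow, Real.sq_sqrt (by positivity)]
  ring

/-- **(E): (3.8)ᴿ in `L²(ℝ)`.** Under RH, for a test function `ψ`, the class of `P̂ᴿ_{Dψ}`
(Prop 1.3ᴿ, `memLp_screwPhatR`) is the `L²`-sum `Σ_ρ c_ρ(ψ)·[F_ρ]` over the orthonormal family of
CJM Prop 4.1, `c_ρ(ψ) = −√(πm_ρ) ψ̂(γ_ρ)`: the pointwise a.e. expansion
`screwPhatR_suzukiD_eq_tsum_screwBasis` is an `L²` expansion because the coefficients are in `ℓ²`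
and the family is orthonormal. RH-CONSEQUENCE (binder kept).
[cite: Suzuki2025WeilHilbertSpace, (3.8) (TeX l.1050–1058) with Prop 4.1 (l.1120–1141), proof of Thm 5.6 (l.1811–1820); erratum E21] -/
theorem hasSum_smul_screwBasis_toLp_screwPhatR (hRH : RiemannHypothesis)
    (hF : ∀ ρ : riemannZetaNontrivialZeros, MemLp (fun x : ℝ ↦ screwBasis (ρ : ℂ) x) 2 volume)
    (hON : Orthonormal ℂ fun ρ : riemannZetaNontrivialZeros ↦
      ((hF ρ).toLp _ : Lp ℂ 2 (volume : Measure ℝ)))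
    {ψ : ℝ → ℂ} (hψ : IsWeilTest ψ) :
    HasSum (fun ρ : riemannZetaNontrivialZeros ↦
        (-((Real.sqrt (Real.pi * riemannZetaZeroOrder (ρ : ℂ)) : ℝ) : ℂ) *
          suzukiHat ψ (suzukiZeroParam (ρ : ℂ))) • ((hF ρ).toLp _ : Lp ℂ 2 (volume : Measure ℝ)))
      ((memLp_screwPhatR hψ.suzukiD).toLp _) := by
  classical
  set c : riemannZetaNontrivialZeros → ℂ := fun ρ ↦
    -((Real.sqrt (Real.pi * riemannZetaZeroOrder (ρ : ℂ)) : ℝ) : ℂ) *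
      suzukiHat ψ (suzukiZeroParam (ρ : ℂ)) with hc
  have hcsum : Summable fun ρ ↦ ‖c ρ‖ ^ 2 := summable_norm_sq_coeff hRH hψ
  obtain ⟨hsG, -⟩ := parseval_of_orthonormal hON hcsum
  have hGae : ((∑' ρ, c ρ • ((hF ρ).toLp _ : Lp ℂ 2 (volume : Measure ℝ)) : Lp ℂ 2 volume) :
      ℝ → ℂ) =ᵐ[volume] fun x ↦ screwPhatR (suzukiD ψ) x := by
    have h1 := coeFn_tsum_smul_toLp_ae_eq hF hsG
      (ae_of_all _ fun x ↦ summable_coeff_mul_screwBasis hψ x)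
    filter_upwards [h1, ae_good_point] with x hx ⟨hx0, hE, hxΓ, hxΓ'⟩
    rw [hx, screwPhatR_suzukiD_eq_tsum_screwBasis hψ hx0 hE hxΓ hxΓ']
  have hG : (∑' ρ, c ρ • ((hF ρ).toLp _ : Lp ℂ 2 (volume : Measure ℝ)) : Lp ℂ 2 volume) =
      (memLp_screwPhatR hψ.suzukiD).toLp _ :=
    Lp.ext (hGae.trans (MemLp.coeFn_toLp _).symm)
  rw [← hG]
  exact hsG.hasSum

/-! ## C. The dictionary `V°(0)ᴿ ↔ 𝖥`: `IsVcircRepR ψ₀ ψ ⟺ 𝖥ψ = [P̂ᴿ_{Dψ₀}]` (RH-FREE) -/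

/-- `(𝖥ψ)(u) = (𝓕ψ)(−u/2π)` almost everywhere (Suzuki's `𝖥` on `L²` versus Mathlib's `𝓕` on
`L²`). [cite: Suzuki2025WeilHilbertSpace, eq. (1.1) (TeX l.240–246)] -/
theorem coeFn_suzukiFourierL2_ae_eq_fourier (ψ : Lp ℂ 2 (volume : Measure ℝ)) :
    (suzukiFourierL2 ψ : ℝ → ℂ) =ᵐ[volume]
      fun u : ℝ ↦ ((𝓕 ψ : Lp ℂ 2 (volume : Measure ℝ)) : ℝ → ℂ) (-(2 * Real.pi)⁻¹ * u) := by
  have hc : (2 * Real.pi)⁻¹ ≠ 0 := inv_ne_zero Real.two_pi_pos.ne'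
  have hq := (measurePreserving_mul_left hc).quasiMeasurePreserving.mono_right
    Measure.smul_absolutelyContinuous
  have hinv : ((𝓕⁻ ψ : Lp ℂ 2 (volume : Measure ℝ)) : ℝ → ℂ) =ᵐ[volume]
      fun w : ℝ ↦ ((𝓕 ψ : Lp ℂ 2 (volume : Measure ℝ)) : ℝ → ℂ) (-w) := by
    rw [fourierInv_eq_compNeg_fourier]
    exact coeFn_compNeg _
  filter_upwards [coeFn_suzukiFourierL2 ψ, hq.ae hinv] with u e1 e2
  rw [e1, e2, neg_mul]

/-- **`IsVcircRepR ψ₀ ψ ⟺ 𝖥ψ = [P̂ᴿ_{Dψ₀}]`**: "`ψ = 𝖥⁻¹P̂ᴿ_{Dψ₀}`" (written with Mathlib's `𝓕` in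
`IsVcircRepR`) says exactly that Suzuki's `𝖥ψ` (`suzukiFourierL2 ψ`) is the `L²`-class of
`P̂ᴿ_{Dψ₀}` (Prop 1.3ᴿ `memLp_screwPhatR`). RH-FREE.
[cite: Suzuki2025WeilHilbertSpace, Cor 1.5 (TeX l.438–444: "V°(0) := {𝖥⁻¹P̂_{Dψ} | ψ ∈ C_c^∞(ℝ)}"); erratum E21] -/
theorem isVcircRepR_iff_suzukiFourierL2_eq {ψ₀ : ℝ → ℂ} (hψ₀ : IsWeilTest ψ₀)
    (ψ : Lp ℂ 2 (volume : Measure ℝ)) :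
    IsVcircRepR ψ₀ ψ ↔
      suzukiFourierL2 ψ = (memLp_screwPhatR hψ₀.suzukiD).toLp (fun x : ℝ ↦ screwPhatR (suzukiD ψ₀) x) := by
  have hc₁ : -(2 * Real.pi)⁻¹ ≠ 0 := neg_ne_zero.2 (inv_ne_zero Real.two_pi_pos.ne')
  have hc₂ : -(2 * Real.pi) ≠ 0 := neg_ne_zero.2 Real.two_pi_pos.ne'
  have hq₁ := (measurePreserving_mul_left hc₁).quasiMeasurePreserving.mono_right
    Measure.smul_absolutelyContinuous
  have hq₂ := (measurePreserving_mul_left hc₂).quasiMeasurePreserving.mono_right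
    Measure.smul_absolutelyContinuous
  have hA := coeFn_suzukiFourierL2_ae_eq_fourier ψ
  constructor
  · intro h
    -- transport `(𝓕ψ)(ξ) = P̂ᴿ(−2πξ)` along `ξ = −u/2π`
    have h' := hq₁.ae h
    apply Lp.ext
    filter_upwards [hA, h', (MemLp.coeFn_toLp (memLp_screwPhatR hψ₀.suzukiD))] with u e1 e2 e3
    rw [e1, e3, e2]
    congr 1
    push_cast
    field_simp
  · intro h
    have h' : (suzukiFourierL2 ψ : ℝ → ℂ) =ᵐ[volume] fun x : ℝ ↦ screwPhatR (suzukiD ψ₀) x := by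
      rw [h]; exact MemLp.coeFn_toLp _
    -- `(𝓕ψ)(−u/2π) = P̂ᴿ(u)` a.e., transported along `u = −2πξ`
    have h'' : ∀ᵐ u : ℝ, ((𝓕 ψ : Lp ℂ 2 (volume : Measure ℝ)) : ℝ → ℂ) (-(2 * Real.pi)⁻¹ * u) =
        screwPhatR (suzukiD ψ₀) u := by
      filter_upwards [hA, h'] with u e1 e2
      rw [← e1, e2]
    have h3 := hq₂.ae h''
    unfold IsVcircRepR
    filter_upwards [h3] with ξ hξ
    have e : -(2 * Real.pi)⁻¹ * (-(2 * Real.pi) * ξ) = ξ := by field_simp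
    rw [e] at hξ
    rw [hξ]

/-- **`𝖥(V°(0)ᴿ) = {[P̂ᴿ_{Dψ₀}] | ψ₀ ∈ C_c^∞(ℝ)}`** as subsets of `L²(ℝ)` (`𝖥 = suzukiFourierL2` is
onto, `suzukiFourierL2_surjective`). RH-FREE.
[cite: Suzuki2025WeilHilbertSpace, Cor 1.5 (TeX l.438–444) and §3.3 (l.1095–1099: "the image P̂_D(C_c^∞(ℝ))"); erratum E21] -/
theorem suzukiFourierL2_image_suzukiVcircR :
    suzukiFourierL2 '' suzukiVcircR =
      {F | ∃ ψ₀ : ℝ → ℂ, ∃ h : IsWeilTest ψ₀,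
        F = (memLp_screwPhatR h.suzukiD).toLp (fun x : ℝ ↦ screwPhatR (suzukiD ψ₀) x)} := by
  ext F
  constructor
  · rintro ⟨ψ, ⟨ψ₀, hψ₀, hrep⟩, rfl⟩
    exact ⟨ψ₀, hψ₀, (isVcircRepR_iff_suzukiFourierL2_eq hψ₀ ψ).1 hrep⟩
  · rintro ⟨ψ₀, hψ₀, rfl⟩
    obtain ⟨ψ, hψ⟩ := suzukiFourierL2_surjective
      ((memLp_screwPhatR hψ₀.suzukiD).toLp (fun x : ℝ ↦ screwPhatR (suzukiD ψ₀) x))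
    exact ⟨ψ, ⟨ψ₀, hψ₀, (isVcircRepR_iff_suzukiFourierL2_eq hψ₀ ψ).2 hψ⟩, hψ⟩


/-! ## D. (D) — density of the test-function values `(ψ̂(γ_ρ))_ρ` in `ℓ²(Γ, m)` -/

/-- Under RH a non-trivial zero has real part `1/2`. [folklore] -/
private theorem re_eq_half_of_rh (hRH : RiemannHypothesis) {ρ : ℂ} (hρ : ρ ∈ riemannZetaNontrivialZeros) :
    ρ.re = 1 / 2 := by
  refine hRH ρ (riemannZetaNontrivialZeros.zeta_eq_zero hρ) ?_ (riemannZetaNontrivialZeros.ne_one hρ)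
  rintro ⟨n, rfl⟩
  have h0 := riemannZetaNontrivialZeros.re_pos hρ
  have e : (-2 * ((n : ℂ) + 1)) = ((-2 * ((n : ℝ) + 1) : ℝ) : ℂ) := by push_cast; ring
  rw [e, Complex.ofReal_re] at h0
  have : (0 : ℝ) ≤ n := n.cast_nonneg
  linarith

/-- Under RH Suzuki's parameter of a zero is the REAL number `γ_ρ = −Im ρ`. [cite: Suzuki2025WeilHilbertSpace, eq. (1.1) (γ = i(ρ − ½))] -/
theorem suzukiZeroParam_eq_neg_im_of_rh (hRH : RiemannHypothesis) {ρ : ℂ}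
    (hρ : ρ ∈ riemannZetaNontrivialZeros) : suzukiZeroParam ρ = ((-ρ.im : ℝ) : ℂ) := by
  have hre := re_eq_half_of_rh hRH hρ
  apply Complex.ext
  · simp [suzukiZeroParam, hre]
  · simp [suzukiZeroParam, hre]

/-- **The zeros are isolated (under RH, on the critical line): a uniform gap around a given zero.**
For a non-trivial zero `ρ₀` there is `r > 0` with `|Im ρ − Im ρ₀| ≥ r` for every other non-trivial
zero `ρ` (finitely many zeros have `|Im ρ| ≤ |Im ρ₀| + 1`; under RH distinct zeros have distinct
ordinates). [folklore] -/
private theorem exists_gap_im_of_rh (hRH : RiemannHypothesis) (ρ₀ : riemannZetaNontrivialZeros) :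
    ∃ r : ℝ, 0 < r ∧ ∀ ρ : riemannZetaNontrivialZeros, ρ ≠ ρ₀ →
      r ≤ |(ρ : ℂ).im - (ρ₀ : ℂ).im| := by
  classical
  have hpos : ∀ ρ : riemannZetaNontrivialZeros, ρ ≠ ρ₀ → 0 < |(ρ : ℂ).im - (ρ₀ : ℂ).im| := by
    intro ρ hne
    rw [abs_pos, sub_ne_zero]
    intro him
    apply hne
    apply Subtype.ext
    apply Complex.ext
    · rw [re_eq_half_of_rh hRH ρ.2, re_eq_half_of_rh hRH ρ₀.2]
    · exact him
  set S : Finset riemannZetaNontrivialZeros := (weilZeroFinset (|(ρ₀ : ℂ).im| + 1)).erase ρ₀ with hS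
  set T : Finset ℝ := insert 1 (S.image fun ρ : riemannZetaNontrivialZeros ↦
    |(ρ : ℂ).im - (ρ₀ : ℂ).im|) with hT
  have hTne : T.Nonempty := ⟨1, Finset.mem_insert_self _ _⟩
  refine ⟨T.min' hTne, ?_, fun ρ hne ↦ ?_⟩
  · refine (Finset.lt_min'_iff T hTne).2 fun y hy ↦ ?_
    rcases Finset.mem_insert.1 hy with rfl | hy
    · exact one_pos
    · obtain ⟨ρ, hρS, rfl⟩ := Finset.mem_image.1 hy
      exact hpos ρ (Finset.ne_of_mem_erase hρS)
  · by_cases hle : |(ρ : ℂ).im| ≤ |(ρ₀ : ℂ).im| + 1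
    · refine Finset.min'_le T _ (Finset.mem_insert_of_mem (Finset.mem_image.2 ⟨ρ, ?_, rfl⟩))
      exact Finset.mem_erase.2 ⟨hne, mem_weilZeroFinset.2 hle⟩
    · have h1 : T.min' hTne ≤ 1 := Finset.min'_le T 1 (Finset.mem_insert_self _ _)
      have h2 : 1 ≤ |(ρ : ℂ).im - (ρ₀ : ℂ).im| := by
        have := abs_sub_abs_le_abs_sub (ρ : ℂ).im (ρ₀ : ℂ).im
        rw [not_le] at hle
        linarith
      linarith

/-- **One integration by parts controls the transform in the weighted sup norm**:
`(1 + 2π|ξ|)·|𝓕h(ξ)| ≤ ‖h‖₁ + ‖h′‖₁` for `h ∈ L¹ ∩ C¹` with `h′ ∈ L¹`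
(`𝓕(h′)(ξ) = 2πiξ·𝓕h(ξ)`, `Real.fourier_deriv`). [folklore] -/
private theorem one_add_mul_norm_fourier_le {h : ℝ → ℂ} (hi : Integrable h) (hd : Differentiable ℝ h)
    (hi' : Integrable (deriv h)) (ξ : ℝ) :
    (1 + 2 * Real.pi * |ξ|) * ‖𝓕 h ξ‖ ≤ (∫ t, ‖h t‖) + ∫ t, ‖deriv h t‖ := by
  have h1 : ‖𝓕 h ξ‖ ≤ ∫ t, ‖h t‖ :=
    VectorFourier.norm_fourierIntegral_le_integral_norm _ _ _ _ _
  have h2 : ‖𝓕 (deriv h) ξ‖ ≤ ∫ t, ‖deriv h t‖ :=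
    VectorFourier.norm_fourierIntegral_le_integral_norm _ _ _ _ _
  rw [Real.fourier_deriv hi hd hi'] at h2
  simp only [smul_eq_mul, norm_mul] at h2
  have hn : ‖(2 : ℂ)‖ * ‖(Real.pi : ℂ)‖ * ‖I‖ * ‖(ξ : ℂ)‖ = 2 * Real.pi * |ξ| := by
    simp [abs_of_pos Real.pi_pos]
  rw [hn] at h2
  have h0 : 0 ≤ ‖𝓕 h ξ‖ := norm_nonneg _
  nlinarith

/-- `𝓕f(ξ) − 𝓕g(ξ) = 𝓕(f − g)(ξ)` for integrable `f, g` (linearity of the Fourier integral).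
[folklore] -/
private theorem fourier_apply_sub {f g : ℝ → ℂ} (hf : Integrable f) (hg : Integrable g) (ξ : ℝ) :
    𝓕 f ξ - 𝓕 g ξ = 𝓕 (fun t ↦ f t - g t) ξ := by
  rw [Real.fourier_eq, Real.fourier_eq, Real.fourier_eq,
    ← integral_sub ((Real.fourierIntegral_convergent_iff ξ).2 hf)
      ((Real.fourierIntegral_convergent_iff ξ).2 hg)]
  congr 1 with v
  rw [smul_sub]

/-- The derivative of the dilated cutoff `t ↦ χ(ct)` (as a complex-valued function) is
`c χ′(ct)`. [folklore] -/
private theorem hasDerivAt_ofReal_cutoff (χ : ContDiffBump (0 : ℝ)) (c t : ℝ) :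
    HasDerivAt (fun s : ℝ ↦ ((χ (c * s) : ℝ) : ℂ)) (((c * deriv χ (c * t) : ℝ) : ℂ)) t := by
  have hd : Differentiable ℝ (χ : ℝ → ℝ) := (χ.contDiff (n := 1)).differentiable (by simp)
  have h1 : HasDerivAt (fun s : ℝ ↦ χ (c * s)) (deriv χ (c * t) * (c * 1)) t :=
    ((hd (c * t)).hasDerivAt).comp t ((hasDerivAt_id t).const_mul c)
  have h2 : HasDerivAt (fun s : ℝ ↦ χ (c * s)) (c * deriv χ (c * t)) t :=
    h1.congr_deriv (by ring)
  exact h2.ofReal_comp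

/-- Inside the unit ball the cutoff is `1` and its derivative vanishes. [folklore] -/
private theorem cutoff_eq_one_and_deriv_eq_zero (χ : ContDiffBump (0 : ℝ)) (hχ : χ.rIn = 1) {y : ℝ}
    (hy : |y| < 1) : χ y = 1 ∧ deriv χ y = 0 := by
  have hball : y ∈ Metric.ball (0 : ℝ) χ.rIn := by
    rw [hχ, Metric.mem_ball, dist_zero_right, Real.norm_eq_abs]; exact hy
  have hev := χ.eventuallyEq_one_of_mem_ball hball
  refine ⟨hev.self_of_nhds, ?_⟩
  rw [hev.deriv_eq]
  exact deriv_const y (1 : ℝ)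

/-- **(D): the values `(ψ̂(γ_ρ))_ρ` of test functions approximate every "delta sequence" in the
weighted sense needed for `ℓ²(Γ, m)`.** Under RH, for a non-trivial zero `ρ₀` there are test
functions `ψ_n ∈ C_c^∞(ℝ)` and `ε_n → 0` with
`|ψ̂_n(γ_ρ) − δ_{ρ,ρ₀}| ≤ ε_n/(1 + |Im ρ|)` for every non-trivial zero `ρ` (`γ_ρ = −Im ρ`).
Construction: `ψ_n = χ(·/(n+1))·𝓕⁻¹g` with `g` a smooth bump isolating `Im ρ₀/2π` from the other
`Im ρ/2π` (`exists_gap_im_of_rh`), `𝓕⁻¹g` a Schwartz function with `𝓕(𝓕⁻¹g) = g`; the error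
`h_n = ψ_n − 𝓕⁻¹g` has `‖h_n‖₁ + ‖h_n′‖₁ → 0` (dominated convergence) and
`(1 + |u|)|ĥ_n(u)| ≤ ‖h_n‖₁ + ‖h_n′‖₁`. This is the part of the printed "`𝓗_W ≅ L²(τ)` is an
isomorphism" (Lemma 5.4, via [KrLa14]) that the proof of Thm 5.6 uses. RH enters only through
`γ_ρ ∈ ℝ`. [cite: Suzuki2025WeilHilbertSpace, Lemma 5.4 (TeX l.1559–1572) and proof of Thm 5.6 (TeX l.1821–1840)] -/
theorem exists_isWeilTest_hatValues_tendsto (hRH : RiemannHypothesis)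
    (ρ₀ : riemannZetaNontrivialZeros) :
    ∃ ψ : ℕ → ℝ → ℂ, ∃ ε : ℕ → ℝ, (∀ n, IsWeilTest (ψ n)) ∧ Tendsto ε atTop (𝓝 0) ∧
      ∀ (n : ℕ) (ρ : riemannZetaNontrivialZeros),
        ‖suzukiHat (ψ n) (suzukiZeroParam (ρ : ℂ)) - (if ρ = ρ₀ then 1 else 0)‖ ≤
          ε n / (1 + |(ρ : ℂ).im|) := by
  classical
  obtain ⟨r, hr, hgap⟩ := exists_gap_im_of_rh hRH ρ₀
  set τ₀ : ℝ := (ρ₀ : ℂ).im with hτ₀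
  -- the bump `g` in the frequency variable `ξ = Im ρ / 2π`
  have hπ := Real.pi_pos
  let g : ContDiffBump (τ₀ / (2 * Real.pi)) :=
    ⟨r / (8 * Real.pi), r / (4 * Real.pi), by positivity,
      (div_lt_div_iff_of_pos_left hr (by positivity) (by positivity)).2 (by nlinarith)⟩
  have hg1 : g (τ₀ / (2 * Real.pi)) = 1 :=
    g.one_of_mem_closedBall (Metric.mem_closedBall_self g.rIn_pos.le)
  have hg0 : ∀ ρ : riemannZetaNontrivialZeros, ρ ≠ ρ₀ → g ((ρ : ℂ).im / (2 * Real.pi)) = 0 := by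
    intro ρ hne
    apply g.zero_of_le_dist
    show r / (4 * Real.pi) ≤ dist ((ρ : ℂ).im / (2 * Real.pi)) (τ₀ / (2 * Real.pi))
    rw [Real.dist_eq, ← sub_div, abs_div, abs_of_pos (by positivity : (0 : ℝ) < 2 * Real.pi),
      div_le_div_iff₀ (by positivity) (by positivity)]
    have := hgap ρ hne
    nlinarith
  -- as a complex-valued Schwartz function, and `φ := 𝓕⁻¹ g`
  set G₀ : ℝ → ℂ := fun ξ ↦ ((g ξ : ℝ) : ℂ) with hG₀
  have hGs : ContDiff ℝ ((⊤ : ℕ∞) : WithTop ℕ∞) G₀ := Complex.ofRealCLM.contDiff.comp g.contDiff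
  have hGc : HasCompactSupport G₀ := g.hasCompactSupport.comp_left Complex.ofReal_zero
  set G : SchwartzMap ℝ ℂ := hGc.toSchwartzMap hGs with hG
  have hGapply : ∀ ξ, G ξ = ((g ξ : ℝ) : ℂ) := fun ξ ↦ rfl
  set Ψ : SchwartzMap ℝ ℂ := 𝓕⁻ G with hΨ
  set φ : ℝ → ℂ := fun t ↦ Ψ t with hφ
  have hφΨ : φ = (Ψ : ℝ → ℂ) := rfl
  have hFφ : 𝓕 φ = fun ξ ↦ ((g ξ : ℝ) : ℂ) := by
    rw [hφΨ, ← SchwartzMap.fourier_coe, hΨ, fourier_fourierInv_eq]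
    funext ξ
    exact hGapply ξ
  have hφi : Integrable φ := Ψ.integrable
  have hφd : Differentiable ℝ φ := Ψ.differentiable
  have hφc : Continuous φ := Ψ.continuous
  have hφ'i : Integrable (deriv φ) := (SchwartzMap.derivCLM ℝ ℂ Ψ).integrable
  have hφ'c : Continuous (deriv φ) := (SchwartzMap.derivCLM ℝ ℂ Ψ).continuous
  have hφderiv : ∀ t, HasDerivAt φ (deriv φ t) t := fun t ↦ Ψ.hasDerivAt t
  -- the cutoff `χ`, `= 1` on `[-1,1]`, supported in `[-2,2]`, with `|χ′| ≤ K`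
  let χ : ContDiffBump (0 : ℝ) := ⟨1, 2, one_pos, one_lt_two⟩
  have hχrIn : χ.rIn = 1 := rfl
  have hχc : Continuous (χ : ℝ → ℝ) := χ.continuous
  have hχ'c : Continuous (deriv χ) := (χ.contDiff (n := 1)).continuous_deriv (by simp)
  obtain ⟨K, hK⟩ := hχ'c.bounded_above_of_compact_support χ.hasCompactSupport.deriv
  have hK0 : 0 ≤ K := (norm_nonneg _).trans (hK 0)
  have hχ1 : ∀ y, ‖((χ y : ℝ) : ℂ) - 1‖ ≤ 1 := by
    intro y
    have h0 := χ.nonneg (x := y)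
    have h1 := χ.le_one (x := y)
    rw [← Complex.ofReal_one, ← Complex.ofReal_sub, Complex.norm_real, Real.norm_eq_abs, abs_le]
    constructor <;> linarith
  -- the scales `c_n = 1/(n+1)` and the functions
  set c : ℕ → ℝ := fun n ↦ ((n : ℝ) + 1)⁻¹ with hc
  have hc0 : ∀ n, 0 < c n := fun n ↦ by positivity
  have hc1 : ∀ n, c n ≤ 1 := fun n ↦ by
    rw [hc]
    exact inv_le_one_of_one_le₀ (by linarith [(n.cast_nonneg : (0 : ℝ) ≤ n)])
  set ψ : ℕ → ℝ → ℂ := fun n t ↦ ((χ (c n * t) : ℝ) : ℂ) * φ t with hψ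
  set h : ℕ → ℝ → ℂ := fun n t ↦ (((χ (c n * t) : ℝ) : ℂ) - 1) * φ t with hh
  set h' : ℕ → ℝ → ℂ := fun n t ↦ ((c n * deriv χ (c n * t) : ℝ) : ℂ) * φ t +
    (((χ (c n * t) : ℝ) : ℂ) - 1) * deriv φ t with hh'
  -- calculus of `h_n`
  have hderiv : ∀ n t, HasDerivAt (h n) (h' n t) t := by
    intro n t
    have hA := hasDerivAt_ofReal_cutoff χ (c n) t
    exact (hA.sub_const (1 : ℂ)).mul (hφderiv t)
  have hderiv' : ∀ n, deriv (h n) = h' n := fun n ↦ funext fun t ↦ (hderiv n t).deriv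
  have hdiff : ∀ n, Differentiable ℝ (h n) := fun n t ↦ (hderiv n t).differentiableAt
  have hcutc : ∀ n, Continuous fun t : ℝ ↦ ((χ (c n * t) : ℝ) : ℂ) := fun n ↦
    Complex.continuous_ofReal.comp (hχc.comp (continuous_const.mul continuous_id))
  have hcut'c : ∀ n, Continuous fun t : ℝ ↦ ((c n * deriv χ (c n * t) : ℝ) : ℂ) := fun n ↦
    Complex.continuous_ofReal.comp (continuous_const.mul (hχ'c.comp (continuous_const.mul continuous_id)))
  have hhi : ∀ n, Integrable (h n) := fun n ↦
    hφi.bdd_mul ((hcutc n).sub continuous_const).aestronglyMeasurable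
      (ae_of_all _ fun t ↦ hχ1 (c n * t))
  have hbd' : ∀ n t, ‖((c n * deriv χ (c n * t) : ℝ) : ℂ)‖ ≤ K := by
    intro n t
    rw [Complex.norm_real, norm_mul, Real.norm_of_nonneg (hc0 n).le]
    calc c n * ‖deriv χ (c n * t)‖ ≤ 1 * K :=
          mul_le_mul (hc1 n) (hK _) (norm_nonneg _) zero_le_one
      _ = K := one_mul K
  have hh'i : ∀ n, Integrable (h' n) := fun n ↦
    (hφi.bdd_mul (hcut'c n).aestronglyMeasurable (ae_of_all _ fun t ↦ hbd' n t)).add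
      (hφ'i.bdd_mul ((hcutc n).sub continuous_const).aestronglyMeasurable
        (ae_of_all _ fun t ↦ hχ1 (c n * t)))
  have hhc : ∀ n, Continuous (h n) := fun n ↦ ((hcutc n).sub continuous_const).mul hφc
  have hh'c : ∀ n, Continuous (h' n) := fun n ↦
    ((hcut'c n).mul hφc).add (((hcutc n).sub continuous_const).mul hφ'c)
  -- pointwise: `h_n(t) = h_n'(t) = 0` as soon as `n + 1 > |t|`
  have hev : ∀ t : ℝ, ∀ᶠ n : ℕ in atTop, h n t = 0 ∧ h' n t = 0 := by
    intro t
    refine Filter.eventually_atTop.2 ⟨⌈|t|⌉₊, fun n hn ↦ ?_⟩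
    have hn' : |t| < (n : ℝ) + 1 := by
      have := Nat.le_ceil |t|
      have : (⌈|t|⌉₊ : ℝ) ≤ n := by exact_mod_cast hn
      linarith
    have hlt : |c n * t| < 1 := by
      rw [abs_mul, abs_of_pos (hc0 n), hc]
      rw [inv_mul_lt_iff₀ (by positivity : (0 : ℝ) < (n : ℝ) + 1)]
      linarith
    obtain ⟨e1, e2⟩ := cutoff_eq_one_and_deriv_eq_zero χ hχrIn hlt
    simp only [hh, hh', e1, e2, Complex.ofReal_one, sub_self, zero_mul, mul_zero,
      Complex.ofReal_zero, add_zero, and_self]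
  -- `ε_n := ‖h_n‖₁ + ‖h_n'‖₁ → 0` by dominated convergence
  set ε : ℕ → ℝ := fun n ↦ (∫ t, ‖h n t‖) + ∫ t, ‖h' n t‖ with hε
  have hε1 : Tendsto (fun n ↦ ∫ t, ‖h n t‖) atTop (𝓝 0) := by
    have h := tendsto_integral_of_dominated_convergence (fun t ↦ ‖φ t‖)
      (fun n ↦ (hhc n).norm.aestronglyMeasurable) hφi.norm
      (fun n ↦ ae_of_all _ fun t ↦ by
        rw [Real.norm_of_nonneg (norm_nonneg _), hh]
        simp only [norm_mul]
        calc ‖((χ (c n * t) : ℝ) : ℂ) - 1‖ * ‖φ t‖ ≤ 1 * ‖φ t‖ :=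
              mul_le_mul_of_nonneg_right (hχ1 _) (norm_nonneg _)
          _ = ‖φ t‖ := one_mul _)
      (ae_of_all _ fun t ↦ by
        refine (tendsto_const_nhds (x := (0 : ℝ))).congr' ?_
        filter_upwards [hev t] with n hn
        rw [hn.1, norm_zero])
    simpa using h
  have hε2 : Tendsto (fun n ↦ ∫ t, ‖h' n t‖) atTop (𝓝 0) := by
    have h := tendsto_integral_of_dominated_convergence (fun t ↦ K * ‖φ t‖ + ‖deriv φ t‖)
      (fun n ↦ (hh'c n).norm.aestronglyMeasurable) ((hφi.norm.const_mul K).add hφ'i.norm)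
      (fun n ↦ ae_of_all _ fun t ↦ by
        rw [Real.norm_of_nonneg (norm_nonneg _), hh']
        refine (norm_add_le _ _).trans (add_le_add ?_ ?_)
        · rw [norm_mul]
          exact mul_le_mul_of_nonneg_right (hbd' n t) (norm_nonneg _)
        · rw [norm_mul]
          calc ‖((χ (c n * t) : ℝ) : ℂ) - 1‖ * ‖deriv φ t‖ ≤ 1 * ‖deriv φ t‖ :=
                mul_le_mul_of_nonneg_right (hχ1 _) (norm_nonneg _)
            _ = ‖deriv φ t‖ := one_mul _)
      (ae_of_all _ fun t ↦ by
        refine (tendsto_const_nhds (x := (0 : ℝ))).congr' ?_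
        filter_upwards [hev t] with n hn
        rw [hn.2, norm_zero])
    simpa using h
  have hεlim : Tendsto ε atTop (𝓝 0) := by
    have := hε1.add hε2
    simpa [hε] using this
  -- the weighted sup-norm estimate for `𝓕 h_n`
  have hkey : ∀ n (ξ : ℝ), (1 + 2 * Real.pi * |ξ|) * ‖𝓕 (ψ n) ξ - ((g ξ : ℝ) : ℂ)‖ ≤ ε n := by
    intro n ξ
    have hsub : 𝓕 (ψ n) ξ - ((g ξ : ℝ) : ℂ) = 𝓕 (h n) ξ := by
      have e1 : ((g ξ : ℝ) : ℂ) = 𝓕 φ ξ := by rw [hFφ]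
      have hψi : Integrable (ψ n) :=
        hφi.bdd_mul (hcutc n).aestronglyMeasurable (ae_of_all _ fun t ↦ by
          rw [Complex.norm_real, Real.norm_of_nonneg (χ.nonneg (x := c n * t))]
          exact χ.le_one)
      have e2 : (fun t ↦ ψ n t - φ t) = h n := by
        funext t
        simp only [hψ, hh]
        ring
      rw [e1, fourier_apply_sub hψi hφi, e2]
    rw [hsub]
    show _ ≤ (∫ t, ‖h n t‖) + ∫ t, ‖h' n t‖
    rw [← hderiv' n]
    exact one_add_mul_norm_fourier_le (hhi n) (hdiff n) (by rw [hderiv' n]; exact hh'i n) ξ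
  -- conclusion
  refine ⟨ψ, ε, fun n ↦ ⟨?_, ?_⟩, hεlim, fun n ρ ↦ ?_⟩
  · -- smoothness of `ψ_n`
    have h1 : ContDiff ℝ ((⊤ : ℕ∞) : WithTop ℕ∞) fun t : ℝ ↦ ((χ (c n * t) : ℝ) : ℂ) :=
      Complex.ofRealCLM.contDiff.comp (χ.contDiff.comp (contDiff_const.mul contDiff_id))
    exact h1.mul (Ψ.smooth ⊤)
  · -- compact support of `ψ_n`: the cutoff vanishes off `[-2(n+1), 2(n+1)]`
    have hcs : HasCompactSupport fun t : ℝ ↦ ((χ (c n * t) : ℝ) : ℂ) := by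
      refine HasCompactSupport.intro (isCompact_closedBall (0 : ℝ) (2 * ((n : ℝ) + 1)))
        fun t ht ↦ ?_
      rw [Metric.mem_closedBall, dist_zero_right, Real.norm_eq_abs, not_le] at ht
      have hz : χ (c n * t) = 0 := by
        apply χ.zero_of_le_dist
        show (2 : ℝ) ≤ dist (c n * t) 0
        rw [Real.dist_eq, sub_zero, abs_mul, abs_of_pos (hc0 n), hc,
          le_inv_mul_iff₀ (by positivity : (0 : ℝ) < (n : ℝ) + 1)]
        linarith
      rw [hz, Complex.ofReal_zero]
    exact hcs.mul_right
  · -- the estimate at `ξ = Im ρ / 2π`, where `γ_ρ = −Im ρ` under RH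
    have hγ : suzukiZeroParam (ρ : ℂ) = ((-(ρ : ℂ).im : ℝ) : ℂ) :=
      suzukiZeroParam_eq_neg_im_of_rh hRH ρ.2
    have hval : suzukiHat (ψ n) (suzukiZeroParam (ρ : ℂ)) = 𝓕 (ψ n) ((ρ : ℂ).im / (2 * Real.pi)) := by
      rw [hγ, suzukiHat_ofReal_eq_fourier, neg_neg]
    have hδ : (if ρ = ρ₀ then (1 : ℂ) else 0) = ((g ((ρ : ℂ).im / (2 * Real.pi)) : ℝ) : ℂ) := by
      split_ifs with hρ
      · rw [hρ, ← hτ₀, hg1, Complex.ofReal_one]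
      · rw [hg0 ρ hρ, Complex.ofReal_zero]
    have hk := hkey n ((ρ : ℂ).im / (2 * Real.pi))
    have habs : 2 * Real.pi * |(ρ : ℂ).im / (2 * Real.pi)| = |(ρ : ℂ).im| := by
      rw [abs_div, abs_of_pos (by positivity : (0 : ℝ) < 2 * Real.pi)]
      field_simp
    rw [habs] at hk
    rw [hval, hδ, le_div_iff₀ (by positivity), mul_comm]
    exact hk


/-! ## E. (L) — the glue: `closure 𝖥(V°(0)ᴿ)` is the closed span of the `[F_ρ]` -/

/-- `D(ψ₁ + ψ₂) = Dψ₁ + Dψ₂` for test functions. [cite: Suzuki2025WeilHilbertSpace, (1.8) (TeX l.412–416)] -/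
theorem suzukiD_add {ψ₁ ψ₂ : ℝ → ℂ} (h₁ : IsWeilTest ψ₁) (h₂ : IsWeilTest ψ₂) :
    suzukiD (ψ₁ + ψ₂) = suzukiD ψ₁ + suzukiD ψ₂ := by
  funext t
  simp only [suzukiD, Pi.add_apply]
  rw [deriv_add (h₁.1.differentiable (by simp) t) (h₂.1.differentiable (by simp) t)]
  ring

/-- `D(kψ) = k·Dψ`. [cite: Suzuki2025WeilHilbertSpace, (1.8) (TeX l.412–416)] -/
theorem suzukiD_const_mul (ψ : ℝ → ℂ) (k : ℂ) :
    suzukiD (fun t ↦ k * ψ t) = fun t ↦ k * suzukiD ψ t := by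
  funext t
  simp only [suzukiD]
  rw [deriv_const_mul_field']
  ring

/-- **`𝖥(V°(0)ᴿ) = {[P̂ᴿ_{Dψ₀}]}` is a linear subspace of `L²(ℝ)`** (`ψ₀ ↦ P̂ᴿ_{Dψ₀}` is linear on
`C_c^∞(ℝ)`: `screwPhatR_add`, `screwPhatR_const_mul`). [cite: Suzuki2025WeilHilbertSpace, §3.3 (TeX l.1095–1099: "the image P̂_D(C_c^∞(ℝ))" as a subspace of L²(ℝ)); erratum E21] -/
theorem exists_submodule_coe_eq_image :
    ∃ W : Submodule ℂ (Lp ℂ 2 (volume : Measure ℝ)),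
      (W : Set (Lp ℂ 2 (volume : Measure ℝ))) =
        {F | ∃ ψ₀ : ℝ → ℂ, ∃ h : IsWeilTest ψ₀,
          F = (memLp_screwPhatR h.suzukiD).toLp (fun x : ℝ ↦ screwPhatR (suzukiD ψ₀) x)} := by
  refine ⟨{ carrier := {F | ∃ ψ₀ : ℝ → ℂ, ∃ h : IsWeilTest ψ₀,
              F = (memLp_screwPhatR h.suzukiD).toLp (fun x : ℝ ↦ screwPhatR (suzukiD ψ₀) x)}
            add_mem' := ?_, zero_mem' := ?_, smul_mem' := ?_ }, rfl⟩
  · rintro F₁ F₂ ⟨ψ₁, h₁, rfl⟩ ⟨ψ₂, h₂, rfl⟩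
    refine ⟨ψ₁ + ψ₂, h₁.add h₂, ?_⟩
    rw [← MemLp.toLp_add]
    refine MemLp.toLp_congr _ _ (ae_of_all _ fun x ↦ ?_)
    simp only [Pi.add_apply]
    rw [suzukiD_add h₁ h₂, screwPhatR_add h₁.suzukiD h₂.suzukiD]
  · have hz : IsWeilTest (0 : ℝ → ℂ) := ⟨contDiff_const, HasCompactSupport.zero⟩
    refine ⟨0, hz, ?_⟩
    symm
    rw [Lp.eq_zero_iff_ae_eq_zero]
    filter_upwards [MemLp.coeFn_toLp (memLp_screwPhatR hz.suzukiD)] with x hx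
    rw [hx]
    have hD : suzukiD (0 : ℝ → ℂ) = fun t ↦ (0 : ℂ) * (0 : ℝ → ℂ) t := by
      funext t; simp [suzukiD]
    rw [hD, screwPhatR_const_mul, zero_mul]
    rfl
  · rintro a F ⟨ψ₀, h₀, rfl⟩
    refine ⟨fun t ↦ a * ψ₀ t, h₀.const_mul a, ?_⟩
    rw [← MemLp.toLp_const_smul]
    refine MemLp.toLp_congr _ _ (ae_of_all _ fun x ↦ ?_)
    simp only [Pi.smul_apply, smul_eq_mul]
    rw [suzukiD_const_mul, screwPhatR_const_mul]

/-- `‖ψ‖ = ‖𝖥ψ‖/√(2π)` (Plancherel for Suzuki's `𝖥`, `norm_sq_suzukiFourierL2`).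
[cite: Suzuki2025WeilHilbertSpace, (5.8) (TeX l.1697)] -/
theorem norm_eq_norm_suzukiFourierL2_div (ψ : Lp ℂ 2 (volume : Measure ℝ)) :
    ‖ψ‖ = ‖suzukiFourierL2 ψ‖ / Real.sqrt (2 * Real.pi) := by
  have h := norm_sq_suzukiFourierL2 ψ
  have hs : Real.sqrt (2 * Real.pi) ≠ 0 := (Real.sqrt_pos.2 Real.two_pi_pos).ne'
  rw [eq_div_iff hs]
  have h2 : ‖suzukiFourierL2 ψ‖ = Real.sqrt (2 * Real.pi * ‖ψ‖ ^ 2) := by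
    rw [← h, Real.sqrt_sq (norm_nonneg _)]
  rw [h2, Real.sqrt_mul Real.two_pi_pos.le, Real.sqrt_sq (norm_nonneg _), mul_comm]

/-- **`𝖥` respects closures**: `ψ ∈ closure A ⟺ 𝖥ψ ∈ closure 𝖥(A)` (`𝖥 = suzukiFourierL2` is a
linear homeomorphism of `L²(ℝ)` onto itself, an isometry up to `√(2π)`). RH-FREE.
[cite: Suzuki2025WeilHilbertSpace, §5 (TeX l.1441: "𝖥 is an isometry up to a constant factor")] -/
theorem mem_closure_iff_suzukiFourierL2_mem_closure_image (A : Set (Lp ℂ 2 (volume : Measure ℝ)))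
    (ψ : Lp ℂ 2 (volume : Measure ℝ)) :
    ψ ∈ closure A ↔ suzukiFourierL2 ψ ∈ closure (suzukiFourierL2 '' A) := by
  constructor
  · intro h
    exact map_mem_closure continuous_suzukiFourierL2 h (mapsTo_image _ _)
  · intro h
    obtain ⟨y, hyA, hylim⟩ := mem_closure_iff_seq_limit.1 h
    choose a haA hay using hyA
    refine mem_closure_of_tendsto (f := a) (b := atTop) ?_ (Eventually.of_forall haA)
    rw [tendsto_iff_norm_sub_tendsto_zero]
    have h1 : Tendsto (fun n ↦ ‖y n - suzukiFourierL2 ψ‖) atTop (𝓝 0) :=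
      tendsto_iff_norm_sub_tendsto_zero.1 hylim
    have h2 : ∀ n, ‖a n - ψ‖ = ‖y n - suzukiFourierL2 ψ‖ / Real.sqrt (2 * Real.pi) := by
      intro n
      rw [norm_eq_norm_suzukiFourierL2_div, suzukiFourierL2_sub, hay n]
    simp_rw [h2]
    simpa using h1.div_const (Real.sqrt (2 * Real.pi))

/-- **Each basis vector `[F_{ρ₀}]` is an `L²`-limit of classes `[P̂ᴿ_{Dψ_n}]`** (under RH): with
the test functions of (D), `‖[P̂ᴿ_{Dψ_n}] + √(πm_{ρ₀})[F_{ρ₀}]‖² = Σ_ρ πm_ρ|ψ̂_n(γ_ρ) − δ_{ρρ₀}|²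
≤ π ε_n² Σ_ρ m_ρ/(1 + Im ρ²) → 0` by (E) and Parseval, so `[F_{ρ₀}] ∈ closure 𝖥(V°(0)ᴿ)`.
RH-CONSEQUENCE (binder kept). [cite: Suzuki2025WeilHilbertSpace, proof of Thm 5.6 (TeX l.1821–1840: "P̂_D : 𝓗_W → 𝓚(Θ) provides the inverse … hence onto") with (3.8), Prop 4.1] -/
theorem screwBasis_toLp_mem_topologicalClosure (hRH : RiemannHypothesis)
    (hF : ∀ ρ : riemannZetaNontrivialZeros, MemLp (fun x : ℝ ↦ screwBasis (ρ : ℂ) x) 2 volume)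
    (hON : Orthonormal ℂ fun ρ : riemannZetaNontrivialZeros ↦
      ((hF ρ).toLp _ : Lp ℂ 2 (volume : Measure ℝ)))
    {W : Submodule ℂ (Lp ℂ 2 (volume : Measure ℝ))}
    (hW : (W : Set (Lp ℂ 2 (volume : Measure ℝ))) =
        {F | ∃ ψ₀ : ℝ → ℂ, ∃ h : IsWeilTest ψ₀,
          F = (memLp_screwPhatR h.suzukiD).toLp (fun x : ℝ ↦ screwPhatR (suzukiD ψ₀) x)})
    (ρ₀ : riemannZetaNontrivialZeros) :
    ((hF ρ₀).toLp _ : Lp ℂ 2 (volume : Measure ℝ)) ∈ W.topologicalClosure := by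
  classical
  obtain ⟨ψ, ε, hψ, hε, hbd⟩ := exists_isWeilTest_hatValues_tendsto hRH ρ₀
  set v : riemannZetaNontrivialZeros → Lp ℂ 2 (volume : Measure ℝ) := fun ρ ↦ (hF ρ).toLp _ with hv
  -- the constant `κ := √(π m_{ρ₀}) > 0`
  have hm0 : ∀ ρ : riemannZetaNontrivialZeros, (0 : ℝ) ≤ riemannZetaZeroOrder (ρ : ℂ) :=
    fun ρ ↦ ZetaZeroSum.zeroOrder_nonneg ρ
  have hmpos : (0 : ℝ) < riemannZetaZeroOrder (ρ₀ : ℂ) := by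
    exact_mod_cast (riemannZetaZeroOrder_pos_iff (riemannZetaNontrivialZeros.ne_one ρ₀.2)).2
      (riemannZetaNontrivialZeros.zeta_eq_zero ρ₀.2)
  set κ : ℝ := Real.sqrt (Real.pi * riemannZetaZeroOrder (ρ₀ : ℂ)) with hκ
  have hκpos : 0 < κ := Real.sqrt_pos.2 (by positivity)
  -- coefficient families: `c n ρ = −√(πm_ρ)ψ̂_n(γ_ρ)`, `d ρ = −√(πm_ρ)δ_{ρρ₀}`
  set c : ℕ → riemannZetaNontrivialZeros → ℂ := fun n ρ ↦
    -((Real.sqrt (Real.pi * riemannZetaZeroOrder (ρ : ℂ)) : ℝ) : ℂ) *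
      suzukiHat (ψ n) (suzukiZeroParam (ρ : ℂ)) with hc
  set d : riemannZetaNontrivialZeros → ℂ := fun ρ ↦
    -((Real.sqrt (Real.pi * riemannZetaZeroOrder (ρ : ℂ)) : ℝ) : ℂ) *
      (if ρ = ρ₀ then 1 else 0) with hd
  have hdρ₀ : d ρ₀ = -(κ : ℂ) := by simp [hd, hκ]
  have hd0 : ∀ ρ, ρ ≠ ρ₀ → d ρ = 0 := fun ρ hρ ↦ by simp [hd, hρ]
  -- the classes `P_n := [P̂ᴿ_{Dψ_n}] ∈ W` and their expansions
  set P : ℕ → Lp ℂ 2 (volume : Measure ℝ) := fun n ↦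
    (memLp_screwPhatR (hψ n).suzukiD).toLp (fun x : ℝ ↦ screwPhatR (suzukiD (ψ n)) x) with hP
  have hPW : ∀ n, P n ∈ W := fun n ↦ by
    rw [← SetLike.mem_coe, hW]
    exact ⟨ψ n, hψ n, rfl⟩
  have hPsum : ∀ n, HasSum (fun ρ ↦ c n ρ • v ρ) (P n) := fun n ↦
    hasSum_smul_screwBasis_toLp_screwPhatR hRH hF hON (hψ n)
  have hdsum : HasSum (fun ρ ↦ d ρ • v ρ) (d ρ₀ • v ρ₀) :=
    hasSum_single ρ₀ (fun ρ hρ ↦ by rw [hd0 ρ hρ, zero_smul])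
  have hdiff : ∀ n, HasSum (fun ρ ↦ (c n ρ - d ρ) • v ρ) (P n - d ρ₀ • v ρ₀) := fun n ↦ by
    simpa only [sub_smul] using (hPsum n).sub hdsum
  -- the coefficient differences: `|c n ρ − d ρ| = √(πm_ρ)|ψ̂_n(γ_ρ) − δ| ≤ √(πm_ρ) ε_n/(1+|Im ρ|)`
  have hcd : ∀ n ρ, ‖c n ρ - d ρ‖ ^ 2 ≤
      Real.pi * ε n ^ 2 * ((riemannZetaZeroOrder (ρ : ℂ) : ℝ) / (1 + (ρ : ℂ).im ^ 2)) := by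
    intro n ρ
    have e : c n ρ - d ρ = -((Real.sqrt (Real.pi * riemannZetaZeroOrder (ρ : ℂ)) : ℝ) : ℂ) *
        (suzukiHat (ψ n) (suzukiZeroParam (ρ : ℂ)) - (if ρ = ρ₀ then 1 else 0)) := by
      simp only [hc, hd]; ring
    have h1 := hbd n ρ
    have hpos : (0 : ℝ) < 1 + |(ρ : ℂ).im| := by positivity
    have h0 : 0 ≤ ε n := by
      have := (norm_nonneg _).trans h1
      exact (div_nonneg_iff.1 this).elim (fun h ↦ h.1) fun h ↦ absurd h.2 (not_le.2 hpos)
    have hmρ := hm0 ρ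
    rw [e, norm_mul, norm_neg, Complex.norm_real, Real.norm_of_nonneg (Real.sqrt_nonneg _), mul_pow,
      Real.sq_sqrt (mul_nonneg Real.pi_pos.le hmρ)]
    have h2 : ‖suzukiHat (ψ n) (suzukiZeroParam (ρ : ℂ)) - (if ρ = ρ₀ then 1 else 0)‖ ^ 2 ≤
        (ε n / (1 + |(ρ : ℂ).im|)) ^ 2 := pow_le_pow_left₀ (norm_nonneg _) h1 2
    have h3 : (ε n / (1 + |(ρ : ℂ).im|)) ^ 2 ≤ ε n ^ 2 / (1 + (ρ : ℂ).im ^ 2) := by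
      rw [div_pow, div_le_div_iff₀ (by positivity) (by positivity)]
      have : 1 + (ρ : ℂ).im ^ 2 ≤ (1 + |(ρ : ℂ).im|) ^ 2 := by
        nlinarith [abs_nonneg (ρ : ℂ).im, sq_abs (ρ : ℂ).im]
      exact mul_le_mul_of_nonneg_left this (sq_nonneg _)
    calc Real.pi * (riemannZetaZeroOrder (ρ : ℂ) : ℝ) *
          ‖suzukiHat (ψ n) (suzukiZeroParam (ρ : ℂ)) - (if ρ = ρ₀ then 1 else 0)‖ ^ 2
        ≤ Real.pi * (riemannZetaZeroOrder (ρ : ℂ) : ℝ) * (ε n ^ 2 / (1 + (ρ : ℂ).im ^ 2)) :=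
          mul_le_mul_of_nonneg_left (h2.trans h3) (mul_nonneg Real.pi_pos.le (hm0 ρ))
      _ = Real.pi * ε n ^ 2 * ((riemannZetaZeroOrder (ρ : ℂ) : ℝ) / (1 + (ρ : ℂ).im ^ 2)) := by
          ring
  have hS : Summable fun ρ : riemannZetaNontrivialZeros ↦
      (riemannZetaZeroOrder (ρ : ℂ) : ℝ) / (1 + (ρ : ℂ).im ^ 2) :=
    ZetaZeroSum.summable_zeroOrder_div_one_add_sq
  have hcdsum : ∀ n, Summable fun ρ ↦ ‖c n ρ - d ρ‖ ^ 2 := fun n ↦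
    Summable.of_nonneg_of_le (fun ρ ↦ sq_nonneg _) (hcd n) (hS.mul_left (Real.pi * ε n ^ 2))
  -- Parseval: `‖P_n − d_{ρ₀}•v_{ρ₀}‖² = Σ |c n ρ − d ρ|² ≤ π ε_n² S`
  have hnorm : ∀ n, ‖P n - d ρ₀ • v ρ₀‖ ^ 2 ≤
      Real.pi * ε n ^ 2 * ∑' ρ : riemannZetaNontrivialZeros,
        (riemannZetaZeroOrder (ρ : ℂ) : ℝ) / (1 + (ρ : ℂ).im ^ 2) := by
    intro n
    obtain ⟨-, hpar⟩ := parseval_of_orthonormal hON (hcdsum n)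
    rw [← (hdiff n).tsum_eq, hpar, ← tsum_mul_left]
    exact Summable.tsum_le_tsum (hcd n) (hcdsum n) (hS.mul_left _)
  -- hence `P_n → d_{ρ₀} • v_{ρ₀}`
  set S : ℝ := ∑' ρ : riemannZetaNontrivialZeros,
    (riemannZetaZeroOrder (ρ : ℂ) : ℝ) / (1 + (ρ : ℂ).im ^ 2) with hSdef
  have hS0 : 0 ≤ S := tsum_nonneg fun ρ ↦ div_nonneg (hm0 ρ) (by positivity)
  have hle : ∀ n, ‖P n - d ρ₀ • v ρ₀‖ ≤ Real.sqrt (Real.pi * S) * |ε n| := by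
    intro n
    have h1 : ‖P n - d ρ₀ • v ρ₀‖ ^ 2 ≤ (Real.sqrt (Real.pi * S) * |ε n|) ^ 2 := by
      rw [mul_pow, Real.sq_sqrt (by positivity), sq_abs]
      calc ‖P n - d ρ₀ • v ρ₀‖ ^ 2 ≤ Real.pi * ε n ^ 2 * S := hnorm n
        _ = Real.pi * S * ε n ^ 2 := by ring
    exact (pow_le_pow_iff_left₀ (norm_nonneg _) (by positivity) two_ne_zero).1 h1
  have hT : Tendsto P atTop (𝓝 (d ρ₀ • v ρ₀)) := by
    rw [tendsto_iff_norm_sub_tendsto_zero]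
    have h0 : Tendsto (fun n ↦ Real.sqrt (Real.pi * S) * |ε n|) atTop (𝓝 0) := by
      have := (continuous_abs.tendsto 0).comp hε
      simpa using this.const_mul (Real.sqrt (Real.pi * S))
    exact squeeze_zero (fun n ↦ norm_nonneg _) hle h0
  have hmem : d ρ₀ • v ρ₀ ∈ W.topologicalClosure := by
    rw [← SetLike.mem_coe, Submodule.topologicalClosure_coe]
    exact mem_closure_of_tendsto hT (Eventually.of_forall fun n ↦ hPW n)
  -- divide by `d_{ρ₀} = −κ ≠ 0`
  have hdne : d ρ₀ ≠ 0 := by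
    rw [hdρ₀, neg_ne_zero, Complex.ofReal_ne_zero]; exact hκpos.ne'
  have := W.topologicalClosure.smul_mem (d ρ₀)⁻¹ hmem
  rwa [inv_smul_smul₀ hdne] at this

/-- **`closure 𝖥(V°(0)ᴿ) = 𝓚(Θ_ξ)` (= the closed span of the `[F_ρ]`, CJM Prop 4.1) under RH** —
the repaired "`𝓚₀ = 𝓚(Θ)`" content of CJM Thm 5.6 at the level of `𝖥(V°(0)ᴿ) = P̂ᴿ_D(C_c^∞(ℝ))`:
`⊆` by the expansion (E) (each `[P̂ᴿ_{Dψ}]` lies in the closed span), `⊇` by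
`screwBasis_toLp_mem_topologicalClosure`. RH-CONSEQUENCE (binder kept).
[cite: Suzuki2025WeilHilbertSpace, Thm 5.6 (TeX l.1799–1809: "𝓚₀ = 𝓚(Θ)") and its proof (l.1811–1840); erratum E21] -/
theorem closure_image_suzukiVcircR_eq_modelSpaceL2 (hRH : RiemannHypothesis) :
    closure (suzukiFourierL2 '' suzukiVcircR) = modelSpaceL2 lagariasTheta := by
  classical
  obtain ⟨⟨hF, hON, hspan⟩, -, -⟩ := Suzuki2025_prop41_holds hRH
  obtain ⟨W, hW⟩ := exists_submodule_coe_eq_image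
  set M := (Submodule.span ℂ (Set.range fun ρ : riemannZetaNontrivialZeros ↦
    ((hF ρ).toLp _ : Lp ℂ 2 (volume : Measure ℝ)))).topologicalClosure with hM
  have hWeq : suzukiFourierL2 '' suzukiVcircR = (W : Set (Lp ℂ 2 (volume : Measure ℝ))) := by
    rw [hW, suzukiFourierL2_image_suzukiVcircR]
  have hMc : IsClosed (M : Set (Lp ℂ 2 (volume : Measure ℝ))) :=
    Submodule.isClosed_topologicalClosure _
  rw [hspan, hWeq, ← Submodule.topologicalClosure_coe]
  apply le_antisymm
  · -- `W̄ ≤ M`: every generator `[P̂ᴿ_{Dψ₀}] = Σ c•v` lies in the closed span `M`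
    refine W.topologicalClosure_minimal (fun F hF' ↦ ?_) hMc
    rw [← SetLike.mem_coe, hW] at hF'
    obtain ⟨ψ₀, hψ₀, rfl⟩ := hF'
    have hsum := hasSum_smul_screwBasis_toLp_screwPhatR hRH hF hON hψ₀
    refine hMc.mem_of_tendsto hsum (Eventually.of_forall fun s ↦ ?_)
    refine SetLike.mem_coe.2 (Submodule.sum_mem _ fun ρ _ ↦ Submodule.smul_mem _ _ ?_)
    exact Submodule.le_topologicalClosure _ (Submodule.subset_span (Set.mem_range_self ρ))
  · -- `M ≤ W̄`: the `[F_ρ]` lie in `W̄`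
    refine Submodule.topologicalClosure_minimal _ ?_ W.isClosed_topologicalClosure
    refine Submodule.span_le.2 (Set.range_subset_iff.2 fun ρ ↦ ?_)
    exact screwBasis_toLp_mem_topologicalClosure hRH hF hON hW ρ

end SuzukiVcircClosure

open SuzukiVcircClosure

/-! ## F. The discharge -/

/-- **CJM Thm 5.6 ("𝓚₀ = 𝓚(Θ)"), repaired (E21), under RH**: the `L²(ℝ)`-closure of
`P̂ᴿ_D(C_c^∞(ℝ))` (the repaired `𝓚₀ᴿ`, `screwK0R`) is the model space `𝓚(Θ_ξ)`
(`modelSpaceL2 lagariasTheta`, the object of CJM Prop 4.1). RH-CONSEQUENCE (binder explicit).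
[cite: Suzuki2025WeilHilbertSpace, Thm 5.6 (TeX l.1799–1809); erratum E21] -/
theorem screwK0R_eq_modelSpaceL2_of_riemannHypothesis (hRH : RiemannHypothesis) :
    screwK0R = modelSpaceL2 lagariasTheta := by
  rw [← closure_image_suzukiVcircR_eq_modelSpaceL2 hRH, suzukiFourierL2_image_suzukiVcircR, screwK0R]
  congr 1
  ext F
  constructor
  · rintro ⟨ψ₀, hψ₀, hae⟩
    refine ⟨ψ₀, hψ₀, Lp.ext ?_⟩
    exact hae.trans (MemLp.coeFn_toLp _).symm
  · rintro ⟨ψ₀, hψ₀, rfl⟩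
    exact ⟨ψ₀, hψ₀, MemLp.coeFn_toLp _⟩

/-- **CJM Thm 5.6, last clause, over the repaired screw line — DISCHARGED:** under RH, `V(0)` is the
`L²(ℝ)`-closure of `V°(0)ᴿ = {𝖥⁻¹P̂ᴿ_{Dψ} | ψ ∈ C_c^∞(ℝ)}`. Proof (printed, TeX l.1811–1840, over
the repaired objects): `closure 𝖥(V°(0)ᴿ) = 𝓚(Θ_ξ)` (`closure_image_suzukiVcircR_eq_modelSpaceL2`:
(3.8)ᴿ + Prop 4.1 + density of the test-function values), `𝓚(Θ_ξ) = 𝖥(V(0))` (Lemma 5.1,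
`suzukiFourierL2_mem_modelSpaceL2_iff`), and `𝖥` is a linear homeomorphism of `L²(ℝ)`.
RH-CONSEQUENCE (binder explicit; nothing here bears on the truth of RH).
[cite: Suzuki2025WeilHilbertSpace, Thm 5.6 (TeX l.1799–1809: "In particular, V(0) is the L²-closure of V°(0)"); erratum E21] -/
theorem Suzuki2025_thm56_closureR_holds : Suzuki2025_thm56_closureR := by
  intro hRH
  ext ψ
  rw [mem_closure_iff_suzukiFourierL2_mem_closure_image, closure_image_suzukiVcircR_eq_modelSpaceL2 hRH,
    suzukiFourierL2_mem_modelSpaceL2_iff]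

end Literature.NumberTheory.LFunctions
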